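import Literature.NumberTheory.DiophantineGeometry.AbcGyory2008NumberFields
import Literature.NumberTheory.DiophantineGeometry.AbcWave0UniformABCProofs
import Literature.Barriers.ABC.UniformABCDiscriminantSharp
import Mathlib.Analysis.Complex.Exponential
import HarnessLib

/-!
# Győry 2008, Theorem 1: the `K = ℚ` sentence (p. 287) follows from the general (3.7) — kernel check of `2²³, 653`

`Literature/NumberTheory/DiophantineGeometry/AbcGyory2008RatOfNumberFieldsProofs.lean` — proofs companion
(theorems only; no definition, no named fact) of `AbcGyory2008NumberFields.lean` and `AbcGyory2008.lean`.

Győry writes (p. 287): "In this special situation [coprime positive integers `a + b = c`] Theorem 1 gives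
`log c < 2²³ (P/log* P) N^{653 log₃ N⋆ / log₂ N⋆}`, where `P = P(abc)` and `N⋆ = max(N, 16)`." This file
PROVES that sentence (the named fact `gyory2008_thm1_rat`) from the typed general Theorem 1
(`gyory2008_thm1`, display (3.7)) applied to `K = ℚ` and the point `(a : b : −c)`:
`d = 1`, `Δ_ℚ = 1` (`NumberField.discr ℚ = 1`), `log* 1 = 1`, `c₁₃(1, ·) = 2²³`, `c₁₄(1, ·) = 12.4`,
`H_ℚ(a : b : −c) = c`, `N_ℚ(a, b, −c) = rad(abc)` (every `e_𝔭 = 1`), `P_ℚ(a, b, −c) = P(abc)`, and the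
one numerical step `12.4 + 19.2 log₃ N⋆ ≤ 653 log₃ N⋆`, i.e. `log₃ 16 ≥ 12.4 / 633.8 = 0.01956…`
(`log₃ 16 = 0.01958…`; certified here as `log₃ 16 > 0.01957` from `log 2 > 0.6931471803`,
`e < 2.7182818286` and the Taylor bound `Real.exp_bound'`). So the two typed facts are consistent and the
printed constant `653 = ⌈12.4 / log₃ 16 + 19.2⌉` is checked in the kernel.
[cite: Gyory2008, §3 Theorem 1 (3.7) p. 286 and the `K = ℚ` sentence p. 287]

Main result: `Gyory2008.thm1_rat_of_thm1 : gyory2008_thm1 → gyory2008_thm1_rat`.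

Appendix (dedup record): Győry's `N_K(a, b, c) = ∏_{𝔭 bad} N(𝔭)^{e(𝔭|p)}` (`Gyory2008.radicalK`, typed with
the `LogVolume` ramification index `ramIdx K 𝔭 = Ideal.ramificationIdx' (p_𝔭) 𝔭`) is THE SAME quantity as
Masser's support `S_K(a, b, c)` already in the tree as `Literature.Barriers.ABC.masserSupport` (typed with
Mathlib's `Ideal.ramificationIdx ℤ`) [cite: Masser2002, Theorem (as summarised in Zbl 1030.11011)]:
`Gyory2008.radicalK_eq_masserSupport` PROVES `radicalK a b c = masserSupport a b c`
(via `Ideal.ramificationIdx'_eq_ramificationIdx`), so the two names are interchangeable and every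
statement about `masserSupport` (e.g. `radicalNorm_le_masserSupport`, Masser's sharpness theorem
`UniformABCDiscriminantSharp`) applies to Győry's `N_K`. Also `Gyory2008.maxNorm_le_radicalK` (`P ≤ N` when
the bad primes are finitely many and there is at least one — the step "using `P ≤ N`" of p. 287/p. 292).
-/

noncomputable section

open Real NumberField IsDedekindDomain Finset
open Literature.NumberTheory.DiophantineGeometry.Dioph (logStar logStar_def one_le_logStar)
open Literature.IUT.LogVolume (ramIdx residueChar)
open Literature.Barriers.ABC

namespace Literature.NumberTheory.DiophantineGeometry

namespace Gyory2008

/-! ### The numerical step: `log₃ 16 > 0.01957` -/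

/-- `exp x ≤ 1 + x + x²/2 + (2/9) x³` for `0 ≤ x ≤ 1` (`Real.exp_bound'` with `n = 3`). [folklore] -/
private theorem exp_le_taylor3 {x : ℝ} (h0 : 0 ≤ x) (h1 : x ≤ 1) :
    Real.exp x ≤ 1 + x + x ^ 2 / 2 + x ^ 3 * (4 / 18) := by
  have h := Real.exp_bound' h0 h1 (n := 3) (by norm_num)
  have hs : ∑ m ∈ Finset.range 3, x ^ m / (m.factorial : ℝ) = 1 + x + x ^ 2 / 2 := by
    simp [Finset.sum_range_succ, Nat.factorial]
  rw [hs] at h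
  have h4 : x ^ 3 * ((3 : ℕ) + 1 : ℝ) / (((Nat.factorial 3 : ℕ) : ℝ) * ((3 : ℕ) : ℝ)) = x ^ 3 * (4 / 18) := by
    norm_num [Nat.factorial]; ring
  linarith [h4]

/-- **`log₃ 16 > 0.01957`** (`log₃ 16 = 0.019588…`): `log 16 = 4 log 2 > 2.7725887`, while
`exp(exp 0.01957) < 2.71828183 · 1.0199604 < 2.77254` — the numerical content of Győry's
`653 = ⌈12.4 / log₃ 16 + 19.2⌉`. [cite: Gyory2008, p. 287 (the constant `653`)] -/
theorem log_log_log_sixteen_gt : (0.01957 : ℝ) < Real.log (Real.log (Real.log 16)) := by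
  have h2 := Real.log_two_gt_d9
  have hlog16 : (2.7725887212 : ℝ) < Real.log 16 := by
    have h4 : Real.log 16 = 4 * Real.log 2 := by
      rw [show (16 : ℝ) = 2 ^ 4 by norm_num, Real.log_pow]; norm_num
    rw [h4]; linarith
  -- `exp 0.01957 ≤ 1.0197633`
  have hE1 : Real.exp 0.01957 ≤ 1.0197633 := by
    have := exp_le_taylor3 (x := 0.01957) (by norm_num) (by norm_num)
    have hnum : (1 : ℝ) + 0.01957 + 0.01957 ^ 2 / 2 + 0.01957 ^ 3 * (4 / 18) ≤ 1.0197633 := by norm_num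
    linarith
  -- `exp 1.0197633 < 2.7725887212`
  have hE2 : Real.exp 1.0197633 < 2.7725887212 := by
    rw [show (1.0197633 : ℝ) = 1 + 0.0197633 by norm_num, Real.exp_add]
    have he := Real.exp_one_lt_d9
    have hsmall : Real.exp 0.0197633 ≤ 1.0199604 := by
      have := exp_le_taylor3 (x := 0.0197633) (by norm_num) (by norm_num)
      have hnum : (1 : ℝ) + 0.0197633 + 0.0197633 ^ 2 / 2 + 0.0197633 ^ 3 * (4 / 18) ≤ 1.0199604 := by
        norm_num
      linarith
    have hpos : 0 < Real.exp 0.0197633 := Real.exp_pos _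
    have hpos1 : 0 < Real.exp 1 := Real.exp_pos _
    calc Real.exp 1 * Real.exp 0.0197633 ≤ 2.7182818286 * 1.0199604 := by
          exact mul_le_mul he.le hsmall hpos.le (by norm_num)
      _ < 2.7725887212 := by norm_num
  -- chain: `log 16 > exp (exp 0.01957)` ⇒ `log₂ 16 > exp 0.01957` ⇒ `log₃ 16 > 0.01957`
  have hlog16pos : 0 < Real.log 16 := by linarith
  have hstep1 : Real.exp (Real.exp 0.01957) < Real.log 16 := by
    have := Real.exp_le_exp.mpr hE1
    linarith
  have hll : Real.exp 0.01957 < Real.log (Real.log 16) := (Real.lt_log_iff_exp_lt hlog16pos).mpr hstep1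
  have hllpos : 0 < Real.log (Real.log 16) := lt_trans (Real.exp_pos _) hll
  exact (Real.lt_log_iff_exp_lt hllpos).mpr hll

/-- The exponent comparison behind `653`: for every `N`, with `ℓ₃ = log₃ N⋆ ≥ log₃ 16 > 0.01957`,
`12.4 · 1 + 19.2 ℓ₃ ≤ 653 ℓ₃` (`633.8 · 0.01957 = 12.40…`), hence
`(12.4 · log* 1 + 19.2 log₃ N⋆) / log₂ N⋆ ≤ 653 log₃ N⋆ / log₂ N⋆`. [cite: Gyory2008, p. 287] -/
theorem thm1Exponent_one_le (r : ℕ) (N : ℝ) :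
    thm1Exponent 1 r 1 N ≤ 653 * Real.log (Real.log (Real.log (max N 16))) / Real.log (Real.log (max N 16)) := by
  rw [thm1Exponent_def, c14_one]
  have hls1 : logStar (1 : ℝ) = 1 := by rw [logStar_def]; simp
  rw [hls1]
  have h16 : (16 : ℝ) ≤ max N 16 := le_max_right _ _
  -- `ℓ₃ ≥ log₃ 16 > 0.01957`
  have hl1 : 1 < Real.log (16 : ℝ) := by
    rw [Real.lt_log_iff_exp_lt (by norm_num)]
    have he := Real.exp_one_lt_d9; linarith
  have hll16 : 0 < Real.log (Real.log (16 : ℝ)) := Real.log_pos hl1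
  have hmono : Real.log (Real.log (Real.log 16)) ≤ Real.log (Real.log (Real.log (max N 16))) :=
    Real.log_le_log hll16 (Real.log_le_log (by linarith) (Real.log_le_log (by norm_num) h16))
  have hℓ₃ : (0.01957 : ℝ) < Real.log (Real.log (Real.log (max N 16))) :=
    lt_of_lt_of_le log_log_log_sixteen_gt hmono
  -- denominator `log₂ N⋆ > 0`
  have hden : 0 < Real.log (Real.log (max N 16)) := by
    have hl : 1 < Real.log (max N 16) := lt_of_lt_of_le hl1 (Real.log_le_log (by norm_num) h16)
    exact Real.log_pos hl
  push_cast
  rw [one_mul]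
  apply div_le_div_of_nonneg_right _ hden.le
  nlinarith

/-! ### The point `(a : b : −c)` over `ℚ` -/

/-- Negating the last coordinate does not change the set of bad primes. [folklore] -/
private theorem badPrimes_neg_right {K : Type*} [Field K] [NumberField K] (a b c : K) :
    badPrimes a b (-c) = badPrimes a b c := by
  ext v
  simp [badPrimes, Valuation.map_neg]

/-- Negating the last coordinate does not change the height of a triple. [folklore] -/
private theorem mulHeight_neg_right {K : Type*} [Field K] [NumberField K] (a b c : K) :
    Height.mulHeight ![a, b, -c] = Height.mulHeight ![a, b, c] := by
  have H : ∀ v : AbsoluteValue K ℝ, (⨆ i, v (![a, b, -c] i)) = ⨆ i, v (![a, b, c] i) := by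
    intro v
    congr 1
    funext i
    fin_cases i <;> simp [map_neg_eq_map]
  rcases eq_or_ne ![a, b, c] 0 with h0 | hx
  · have h0' : ![a, b, -c] = 0 := by
      have ha : a = 0 := by simpa using congrFun h0 0
      have hb : b = 0 := by simpa using congrFun h0 1
      have hc : c = 0 := by simpa using congrFun h0 2
      ext i; fin_cases i <;> simp [ha, hb, hc]
    rw [h0, h0']
  · have hx' : ![a, b, -c] ≠ 0 := by
      intro h0
      apply hx
      have ha : a = 0 := by simpa using congrFun h0 0
      have hb : b = 0 := by simpa using congrFun h0 1
      have hc : c = 0 := by simpa using congrFun h0 2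
      ext i; fin_cases i <;> simp [ha, hb, hc]
    simp only [Height.mulHeight_eq hx, Height.mulHeight_eq hx', H]

/-- `e_𝔭 = 1` for every finite place of `ℚ` (copy of the plumbing of `Yu2007PadicLogFormsNumberField`).
[folklore] -/
private theorem ramIdx_rat_eq_one (v : HeightOneSpectrum (𝓞 ℚ)) : ramIdx ℚ v = 1 := by
  have hp := Rat.HeightOneSpectrum.prime_natGenerator v
  have hq := Literature.IUT.LogVolume.residueChar_prime ℚ v
  -- `p_v = natGenerator v`
  have hres : residueChar ℚ v = Rat.HeightOneSpectrum.natGenerator v := by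
    have hmem : ((residueChar ℚ v : ℕ) : 𝓞 ℚ) ∈ v.asIdeal := by
      have h1 : (residueChar ℚ v : ℤ) ∈ v.asIdeal.under ℤ := by
        rw [← (Literature.IUT.LogVolume.liesOver_residueChar ℚ v).over]
        exact Ideal.mem_span_singleton_self _
      rw [Ideal.under_def, Ideal.mem_comap, map_natCast] at h1
      exact h1
    have hdvd := (UniformABCConjecture.natCast_mem_asIdeal_iff v _).1 hmem
    exact ((Nat.prime_dvd_prime_iff_eq hp hq).1 hdvd).symm
  have hmap : Ideal.map (algebraMap ℤ (𝓞 ℚ))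
      (Ideal.span {(Rat.HeightOneSpectrum.natGenerator v : ℤ)}) = v.asIdeal := by
    rw [Ideal.map_span, Set.image_singleton, map_natCast,
      UniformABCConjecture.asIdeal_eq_span_natGenerator v]
  unfold ramIdx
  rw [hres, ← hmap]
  exact Ideal.ramificationIdx'_map_self_eq_one (by rw [hmap]; exact v.isPrime.ne_top)
    (by rw [hmap]; exact v.ne_bot)

/-- Over `ℚ`, Győry's radical of an abc triple `(a : b : −c)` is `rad(abc)`.
[cite: Gyory2008, §3 (3.2), p. 285] -/
theorem radicalK_natCast_eq_rad {a b c : ℕ} (h : IsABCTriple a b c) :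
    radicalK (a : ℚ) (b : ℚ) (-(c : ℚ)) = rad a b c := by
  rw [radicalK_def, badPrimes_neg_right, ← UniformABCConjecture.radicalNorm_natCast_eq_rad h]
  unfold radicalNorm
  exact finprod_mem_congr rfl fun v _ => by rw [ramIdx_rat_eq_one, pow_one]

/-- Over `ℚ`, Győry's `P_ℚ(a, b, −c)` of an abc triple is the greatest prime factor `P(abc)`.
[cite: Gyory2008, §3, p. 285] -/
theorem maxNorm_natCast_eq_largestPrimeFactor {a b c : ℕ} (h : IsABCTriple a b c) :
    maxNorm (a : ℚ) (b : ℚ) (-(c : ℚ)) = largestPrimeFactor (a * b * c) := by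
  classical
  obtain ⟨ha, hb, habc, hcop⟩ := id h
  have hc : 0 < c := by omega
  have habc0 : a * b * c ≠ 0 := by positivity
  set S := badPrimes (a : ℚ) (b : ℚ) (-(c : ℚ)) with hSdef
  have hS : S = badPrimes (a : ℚ) (b : ℚ) (c : ℚ) := by rw [hSdef, badPrimes_neg_right]
  have hmem : ∀ v : HeightOneSpectrum (𝓞 ℚ), v ∈ S ↔ Rat.HeightOneSpectrum.natGenerator v ∣ a * b * c := by
    intro v
    rw [hS]
    exact ⟨UniformABCConjecture.natGenerator_dvd_of_mem_badPrimes,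
      UniformABCConjecture.mem_badPrimes_of_natGenerator_dvd h⟩
  have hfin : S.Finite := by rw [hS]; exact UniformABCConjecture.badPrimes_natCast_finite habc0
  haveI : Finite S := hfin.to_subtype
  -- a bad prime exists: `c ≥ 2` has a prime factor
  obtain ⟨p, hp, hpc⟩ := Nat.exists_prime_and_dvd (show c ≠ 1 by omega)
  set v₀ := (Rat.HeightOneSpectrum.primesEquiv (R := 𝓞 ℚ)).symm ⟨p, hp⟩ with hv₀
  have hv₀gen : Rat.HeightOneSpectrum.natGenerator v₀ = p :=
    congrArg Subtype.val ((Rat.HeightOneSpectrum.primesEquiv (R := 𝓞 ℚ)).apply_symm_apply ⟨p, hp⟩)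
  have hv₀S : v₀ ∈ S := (hmem v₀).2 (by rw [hv₀gen]; exact dvd_mul_of_dvd_right hpc _)
  haveI : Nonempty S := ⟨⟨v₀, hv₀S⟩⟩
  have hne : (a * b * c).primeFactors.Nonempty := by
    rw [Nat.nonempty_primeFactors]
    have hab : 1 ≤ a * b := Nat.one_le_iff_ne_zero.mpr (by positivity)
    have := Nat.mul_le_mul hab (show 2 ≤ c by omega)
    omega
  -- the `iSup` equals the `sup` of the prime factors
  have hsup : (⨆ v : S, Ideal.absNorm v.1.asIdeal) = (a * b * c).primeFactors.sup id := by
    apply le_antisymm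
    · refine ciSup_le fun v => ?_
      rw [UniformABCConjecture.absNorm_asIdeal_eq_natGenerator]
      have hvmem : Rat.HeightOneSpectrum.natGenerator v.1 ∈ (a * b * c).primeFactors :=
        Nat.mem_primeFactors.2 ⟨Rat.HeightOneSpectrum.prime_natGenerator _, (hmem _).1 v.2, habc0⟩
      exact Finset.le_sup (f := id) hvmem
    · refine Finset.sup_le fun q hq => ?_
      obtain ⟨hqp, hqdvd, -⟩ := Nat.mem_primeFactors.1 hq
      set w := (Rat.HeightOneSpectrum.primesEquiv (R := 𝓞 ℚ)).symm ⟨q, hqp⟩ with hw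
      have hwgen : Rat.HeightOneSpectrum.natGenerator w = q :=
        congrArg Subtype.val ((Rat.HeightOneSpectrum.primesEquiv (R := 𝓞 ℚ)).apply_symm_apply ⟨q, hqp⟩)
      have hwS : w ∈ S := (hmem w).2 (by rw [hwgen]; exact hqdvd)
      have hbdd : BddAbove (Set.range fun v : S => Ideal.absNorm v.1.asIdeal) :=
        (Set.finite_range _).bddAbove
      calc id q = Ideal.absNorm (⟨w, hwS⟩ : S).1.asIdeal := by
            rw [UniformABCConjecture.absNorm_asIdeal_eq_natGenerator, hwgen]; rfl
        _ ≤ ⨆ v : S, Ideal.absNorm v.1.asIdeal := le_ciSup hbdd ⟨w, hwS⟩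
  rw [maxNorm_def, hsup, largestPrimeFactor_def]
  have h2 : 2 ≤ (a * b * c).primeFactors.sup id := by
    obtain ⟨q, hq⟩ := hne
    exact (Nat.prime_of_mem_primeFactors hq).two_le.trans (Finset.le_sup (f := id) hq)
  rw [max_eq_right (by omega)]

/-! ### The bridge -/

/-- **The `K = ℚ` sentence of Theorem 1 follows from (3.7).** `gyory2008_thm1 → gyory2008_thm1_rat`:
apply (3.7) to `K = ℚ` and `(a : b : −c)` (`a + b + (−c) = 0`; a bad prime exists since `c ≥ 2`):
`d = 1`, `Δ_ℚ = 1`, `log* 1 = 1`, `c₁₃ = 2²³`, `c₁₄ = 12.4`, `H_ℚ = c`, `N_ℚ = rad(abc)`, `P_ℚ = P(abc)`,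
and `N^{(12.4 + 19.2 log₃ N⋆)/log₂ N⋆} ≤ N^{653 log₃ N⋆ / log₂ N⋆}` by `thm1Exponent_one_le` (`N ≥ 2`).
[cite: Gyory2008, §3 Theorem 1 (3.7) p. 286 and the `K = ℚ` sentence p. 287] -/
theorem thm1_rat_of_thm1 (hG : gyory2008_thm1) : gyory2008_thm1_rat := by
  intro a b c h
  obtain ⟨ha, hb, habc, hcop⟩ := id h
  have hc : 0 < c := by omega
  have hbad : (badPrimes (a : ℚ) (b : ℚ) (-(c : ℚ))).Nonempty := by
    have habc0 : a * b * c ≠ 0 := by positivity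
    obtain ⟨p, hp, hpc⟩ := Nat.exists_prime_and_dvd (show c ≠ 1 by omega)
    refine ⟨(Rat.HeightOneSpectrum.primesEquiv (R := 𝓞 ℚ)).symm ⟨p, hp⟩, ?_⟩
    rw [badPrimes_neg_right]
    apply UniformABCConjecture.mem_badPrimes_of_natGenerator_dvd h
    rw [show Rat.HeightOneSpectrum.natGenerator ((Rat.HeightOneSpectrum.primesEquiv (R := 𝓞 ℚ)).symm ⟨p, hp⟩)
        = p from congrArg Subtype.val
          ((Rat.HeightOneSpectrum.primesEquiv (R := 𝓞 ℚ)).apply_symm_apply ⟨p, hp⟩)]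
    exact dvd_mul_of_dvd_right hpc _
  have key := hG.1 ℚ (a : ℚ) (b : ℚ) (-(c : ℚ)) (by exact_mod_cast ha.ne') (by exact_mod_cast hb.ne')
    (neg_ne_zero.mpr (by exact_mod_cast hc.ne')) (by push_cast [← habc]; ring) hbad
  -- specialise the constants: `d = 1`, `Δ = 1`
  rw [Module.finrank_self, c13_one, Rat.numberField_discr, mulHeight_neg_right,
    UniformABCConjecture.mulHeight_natCast_eq h, radicalK_natCast_eq_rad h,
    maxNorm_natCast_eq_largestPrimeFactor h] at key
  have hls1 : logStar |((1 : ℤ) : ℝ)| = 1 := by rw [logStar_def]; simp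
  have habs1 : |((1 : ℤ) : ℝ)| = 1 := by simp
  rw [hls1, habs1, Real.one_rpow, one_pow, mul_one, mul_one] at key
  -- compare the exponents
  have hR2 : (2 : ℝ) ≤ (rad a b c : ℝ) := by exact_mod_cast h.two_le_rad
  have hR1 : (1 : ℝ) ≤ (rad a b c : ℝ) := by linarith
  have hexp := thm1Exponent_one_le (Units.rank ℚ) (rad a b c : ℝ)
  have hpow : (rad a b c : ℝ) ^ thm1Exponent 1 (Units.rank ℚ) 1 (rad a b c : ℝ) ≤
      (rad a b c : ℝ) ^ (653 * Real.log (Real.log (Real.log (max (rad a b c : ℝ) 16))) /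
        Real.log (Real.log (max (rad a b c : ℝ) 16))) :=
    Real.rpow_le_rpow_of_exponent_le hR1 hexp
  have hP0 : (0 : ℝ) ≤ (2 : ℝ) ^ (23 : ℕ) *
      ((largestPrimeFactor (a * b * c) : ℝ) / logStar (largestPrimeFactor (a * b * c))) := by
    have := one_le_logStar (largestPrimeFactor (a * b * c) : ℝ)
    positivity
  exact lt_of_lt_of_le key (mul_le_mul_of_nonneg_left hpow hP0)

/-! ### Appendix: Győry's `N_K` is Masser's support `S_K`; `P ≤ N` -/

/-- The `LogVolume` ramification index `e_𝔭 = Ideal.ramificationIdx' (p_𝔭) 𝔭` of a finite place of a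
number field agrees with Mathlib's `𝔭.ramificationIdx ℤ`. [folklore] -/
private theorem ramIdx_eq_ramificationIdx {K : Type*} [Field K] [NumberField K]
    (v : HeightOneSpectrum (𝓞 K)) : ramIdx K v = v.asIdeal.ramificationIdx ℤ := by
  unfold Literature.IUT.LogVolume.ramIdx
  have hp : (Ideal.span {(residueChar K v : ℤ)}) ≠ ⊥ := by
    rw [Ne, Ideal.span_singleton_eq_bot]
    exact_mod_cast (Literature.IUT.LogVolume.residueChar_prime K v).ne_zero
  exact Ideal.ramificationIdx'_eq_ramificationIdx _ _ hp

/-- **Győry's radical `N_K(a, b, c)` (3.2) is Masser's support `S_K(a, b, c)`**: the tree's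
`Literature.Barriers.ABC.masserSupport` (`∏_{𝔭 bad} N𝔭^{e(𝔭)}` with Mathlib's `Ideal.ramificationIdx ℤ`)
and `Gyory2008.radicalK` (the same product with `LogVolume.ramIdx`) coincide — one object, two sources.
[cite: Gyory2008, §3 (3.2), p. 285] [cite: Masser2002, Theorem (as summarised in Zbl 1030.11011)] -/
theorem radicalK_eq_masserSupport {K : Type*} [Field K] [NumberField K] (a b c : K) :
    radicalK a b c = Literature.Barriers.ABC.masserSupport a b c := by
  rw [radicalK_def, Literature.Barriers.ABC.masserSupport_def]
  exact finprod_mem_congr rfl fun v _ => by rw [ramIdx_eq_ramificationIdx]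

/-- **`P ≤ N`** ("using `P ≤ N`", p. 287): if the set of bad primes of `(a : b : c)` is finite and
non-empty, the largest norm of a bad prime divides into, hence is at most, Győry's radical
`N_K(a, b, c) = ∏_{𝔭 bad} N𝔭^{e_𝔭}` (every factor is `≥ 1` and `e_𝔭 ≥ 1`). [cite: Gyory2008, p. 287] -/
theorem maxNorm_le_radicalK {K : Type*} [Field K] [NumberField K] {a b c : K}
    (hfin : (badPrimes a b c).Finite) (hne : (badPrimes a b c).Nonempty) :
    maxNorm a b c ≤ radicalK a b c := by
  classical
  haveI : Finite (badPrimes a b c) := hfin.to_subtype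
  haveI : Nonempty (badPrimes a b c) := hne.to_subtype
  rw [maxNorm_def]
  refine ciSup_le fun v => ?_
  rw [radicalK_def, finprod_mem_eq_finite_toFinset_prod _ hfin]
  have hv : v.1 ∈ hfin.toFinset := hfin.mem_toFinset.2 v.2
  have he : 1 ≤ ramIdx K v.1 := Nat.one_le_iff_ne_zero.mpr (Literature.IUT.LogVolume.ramIdx_ne_zero K v.1)
  calc Ideal.absNorm v.1.asIdeal = Ideal.absNorm v.1.asIdeal ^ 1 := (pow_one _).symm
    _ ≤ Ideal.absNorm v.1.asIdeal ^ ramIdx K v.1 :=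
        Nat.pow_le_pow_right (HeightOneSpectrum.one_lt_absNorm v.1).le he
    _ ≤ ∏ w ∈ hfin.toFinset, Ideal.absNorm w.asIdeal ^ ramIdx K w :=
        Finset.single_le_prod' (f := fun w => Ideal.absNorm w.asIdeal ^ ramIdx K w)
          (fun w _ => Nat.one_le_iff_ne_zero.mpr (pow_ne_zero _ (by
            have := HeightOneSpectrum.one_lt_absNorm w; omega))) hv

end Gyory2008

end Literature.NumberTheory.DiophantineGeometry
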